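import Literature.MathematicalPhysics.QuantumFieldTheory.Balaban1983to89.B9B8KnitLetterE12Sup
import Literature.MathematicalPhysics.QuantumFieldTheory.Balaban1983to89.B9B8KnitLetterProjectionC
import Literature.MathematicalPhysics.QuantumFieldTheory.Balaban1983to89.B9Thm39CinvSandwichQ
import Literature.MathematicalPhysics.QuantumFieldTheory.Balaban1983to89.B9Ineq349Hom

/-!
# `Balaban1983to89.B9B8KnitLetterRBound` — [B8] (1.98) `|Rf|₍₋₂₎ ≦ B_R|f|₍₋₂₎` AT THE KNIT LETTER `parKnitY`: the projection
# `R(U) = I − G′Q′*(Q′G′²Q′*)⁻¹Q′G′` of [B9] (3.25) is bounded in the weighted sup norm, from the (3.42)₁ block majorant of `η²G′(U; parKnitY)`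
# and the (3.48)-shape block majorant of `(Q′G′²Q′*)⁻¹(U; parKnitY)` — [B9] p. 399 (3.49) for `P = I − R` «using again Lemma 2.1», in r06's
# typed-carrier form `B9Ineq349Hom.hasMajorantHom_word349` — the consumer's law (E15) `r_bound` of `B8Thm2TorusLetters.LettersAt` at print's own
# transporters (junction J-B file 17)

statement-level skeleton of published theorems with citation tags; proofs where landed; nothing here is a claim about the
Yang–Mills mass gap

T. Bałaban, *Propagators for lattice gauge theories in a background field*, Commun. Math. Phys. **99** (1985) 389–434 [`Balaban1985BackgroundPropagators`,
"[B9]"]; T. Bałaban, *Propagators and renormalization transformations for lattice gauge theories. II*, Commun. Math. Phys. **96** (1984) 223–250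
[`Balaban1984PropagatorsII`, "[4]"]; T. Bałaban, *Spaces of regular gauge field configurations on a lattice and gauge fixing conditions*, Commun. Math.
Phys. **99** (1985) 75–102 [`Balaban1985RegularSpaces`, "[B8]"].

THE PRINT.  [B8] p. 92: *«Let us recall that from Theorems 3.1, 3.2 of [4] it follows that |Rf| ≦ B′₀|f|»* and (1.98) *«The operators R and V are bounded
in this norm, and we have |Rf|₍₋₂₎ ≦ B_R|f|₍₋₂₎»* (`|f|₍₋₂₎ = sup_j sup_{Ω_j}(Lʲη)²|f|`, p. 86) — the consumer's law (E15) `r_bound` of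
`B8Thm2TorusLetters.LettersAt` (`Bd2 … f r → Bd2 … (f − G′Q′ᵀCQ′G′f) (B_R·r)`).  [B9] (3.25) p. 394: `Rf = (I − G′Q′*(Q′G′²Q′*)⁻¹Q′G′)f`; p. 399 (3.49):
*«For the operator P = I − R we obtain, using again Lemma 2.1, |P(x,x′)| ≦ O(1)(L^{j′}η)^{−d}e^{−½δ₀d(y,y′)}»* from Theorem 3.1 (3.42)₁ p. 397 (the kernel
of `G′`) and Theorem 3.2 (3.48) p. 398 (the kernel of `(Q′G′²Q′*)⁻¹`); [4] (2.51)–(2.52) p. 232, Lemma 2.1 (2.61) p. 234, and [B9] p. 398 (the scale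
transfer «we may replace the factor (Lʲη)^α by (Lʲη)^β(L^{j′}η)^γ»).

WHY THIS FILE ∕ THE ARGUMENT.  r06's `B9Ineq349Hom.hasMajorantHom_word349` types the word `X·Q′*·(Q′G′²Q′*)⁻¹·Q′·Y` between its carriers and bounds
it by `κ_Q²B_XB₁B_YΛ⁴c₁² · w_X(a)ℓ(a)⁻⁴w_Y(a) · e^{−ρd}`.  At def-Y's letters, in p21's real coordinates: `X = Y = conj b(η²G′(U; parKnitY))` with the
(3.42)₁ majorant `A·ℓ(a)²·e^{−δd}` (junction files 9 ∕ 15), `Q′`, `Q′*` block-local of norm `κ_Q = M₂Σ‖b_j‖` (M5.6 FILE 3b `B9Thm39CinvSandwichQ`, contractive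
transporters — the knit legs are `G`-valued, `G ≤ U(N)`), and `(Q′G′²Q′*)⁻¹ = conj b(s·XinvY(U; parKnitY))`, `η²·s·η² = 1`, with the (3.48)-shape majorant
`K·ℓ(a)⁻⁴·e^{−δd}` (the OUTPUT SHAPE of M5.6 `B9Thm39CinvTorusRegularFinal.hasMajorant_conj_XinvY_final` ∕ `B9Thm39CinvOfEBlock.hasMajorant_conj_XinvY_of_eBlockInv`
at `parS := parKnitY`, displayed here).  The scale weights cancel (`ℓ²·ℓ⁻⁴·ℓ² = 1`): `conj b(P(U))`, `P = G′Q′*(Q′G′²Q′*)⁻¹Q′G′ = I − R`, has the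
LEVEL-FREE majorant `κ_P·e^{−ρd}`, so `‖(PΛ)(z)‖ ≦ (Σ‖b_j‖)κ_P·c·M₂·sup‖Λ‖` by junction file 11's reading and the row sum `c`, and for EVERY weight `ω > 0`:
`ω‖Λ‖ ≦ r ⇒ ω‖(RΛ)(z)‖ ≦ (1 + (Σ‖b_j‖)κ_P c M₂)·r` — at `ω = (Lⁿη)²` this is (1.98) on the constant-level member, `B_R` free of the member, `n`, `k`, `η`.

CITATION HEADER (lean-in-tree rule).  Cell `lit-balaban`, sub-row G-B9-LETTERS, junction J-B file 17 → seat `lit-balaban-p33` gen 95.  REUSED BY NAME: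
r06 `B9Ineq349Hom.hasMajorantHom_word349`, pv21 `B6RandomWalkHom.{HasMajorantHom, hasMajorantHom_iff, hasMajorantHom_mono}`, p21 `B9Thm39CinvSandwichQ.
{hasMajorantHom_conjHom_QpY, hasMajorantHom_conjHom_QpsY}`, `B9Eq352DivFormLetters.conj`, `B9Eq376POneLetters.{conjHom, conjHom_comp, conjHom_eq_conj}`,
`B9Ineq347.ScaleTransfer`, def-Y `Node00.{RY, XinvY, QpY, QpsY, GpY}`, junction files 6 (`contraction_of_mem_unitary`), 11 (`norm_apply_le_of_hasMajorant_exp`),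
13 (`RY_parKnitY_smul`), J-B 2 (`parKnitY`, `levY_blkCornerY`).

WHAT THIS FILE PROVES (sorry-free; no definitions; the two block majorants and the geometry are DISPLAYED HYPOTHESES of the printed shapes).
* §1 generic letters `parS`, `Gp` (any `𝔸`): `RY_apply'` (`RΛ = Λ − G′Q′*X⁻¹Q′G′Λ`), `smul_word_restrictScalars` (the scale weights cancel), `conj_word`
  (real coordinates of the word), ★★ `hasMajorant_conj_P` — (3.49)₁ for `P = G′Q′*X⁻¹Q′G′`: `conj b(P) ≺ κ_P e^{−ρd}`,
  `κ_P = (M₂Σ‖b_j‖)²·A·K·A·Λ⁴·c₁(δ₀,β)²`, for `ρ + (2α+β)δ₀ ≦ δ`.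
* §2 the member's geometry on a CONSTANT-LEVEL member: `lvl_eq_of_constLev`, `geo9K_len_constLev` (`ℓ(a) = Lⁿ∕|c_f|` for EVERY coarse point), ★
  `scaleTransfer_of_constLev` (the p. 398 scale transfer is free: exponent `0`, constant `1`).
* §3 at the knit letter: `parKnitY_contractive`, ★★ `hasMajorant_conj_P_parKnitY`, ★★ `norm_P_parKnitY_apply_le` (`‖(G′Q′*CQ′G′Λ)(z)‖ ≦ (Σ‖b_j‖)κ_P c M₂·M`),
  ★★★ **`knit_E15`** (`ω‖Λ(w)‖ ≦ r ∀w ⇒ ω‖(RΛ)(z)‖ ≦ (1 + (Σ‖b_j‖)κ_P c M₂)·r`, every `ω > 0`), `knit_E15_smul` (the same at `c·G′`, `c ≠ 0` — `R` is blind to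
  the units of `G′`), ★★★ **`knit_E15_constLev`** (the consumer's letter: `(Lⁿη)²`-weights on a level-`n` member, scale transfers discharged, `α = 0`, `Λ = 1`).

HONEST SCOPE.  Bookkeeping in [4]'s block-majorant calculus; the (3.42)₁ majorant of `η²G′(U; parKnitY)` (supplier: junction file 15 from M5.5's cube data)
and the (3.48)-shape majorant of `s·(Q′G′²Q′*)⁻¹(U; parKnitY)` (supplier: M5.6 at `parS := parKnitY`, its cube letters ∕ [2]-differences ∕ smallness displayed
there) are HYPOTHESES here, as are (2.54), (2.61) and the row sum; operator (block `L^∞`) form of (3.49), not the pointwise kernel form with `(L^{j′}η)^{−d}`.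
Count-neutral; nothing continuum, nothing about OS axioms or the mass gap.  No `sorry`, no `axiom`, no `instance`, no `notation`.  NEW file; nothing landed
is modified.  Net new unproved facts: 0.  Seat `lit-balaban-p33` gen 95, 2026-08-28.
-/

noncomputable section

namespace Literature.MathematicalPhysics.QuantumFieldTheory.Balaban1983to89.B9B8KnitLetterRBound

open Node00 B6KLevelCensusIndexV1 B6Geom246MultiLevelBox B9BackgroundsKLevelV1
open B6RandomWalk (HasMajorant Triangle254 Ineq261 hasMajorant_mono c1_nonneg)
open B6RandomWalkHom (HasMajorantHom hasMajorantHom_mono hasMajorantHom_iff)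
open B9Thm34Ext (toB6)
open B9GeoNormsKLevelV1 (geo9K geo9K_len_kGeo)
open B9Eq352DivFormLetters (conj)
open B9Eq376POneLetters (conjHom conjHom_comp conjHom_eq_conj)
open B9Ineq347 (ScaleTransfer)
open B9Ineq349Hom (hasMajorantHom_word349)
open B9Thm39CinvSandwichQ (hasMajorantHom_conjHom_QpY hasMajorantHom_conjHom_QpsY)
open B9Ineq349SiteComposite (etaS_pos)
open B6Ineq2142KLevelV1 (β lvl beta_level)
open B9B8AveragingJunction (parKnitY levY_blkCornerY)
open B9B8KnitLetterCoercive (contraction_of_mem_unitary)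
open B9B8KnitLetterProjectionC (RY_parKnitY_smul)
open B9B8KnitLetterE12Sup (norm_apply_le_of_hasMajorant_exp)
open scoped Matrix Matrix.Norms.L2Operator

variable {d ℓ : ℕ} {hd : 1 ≤ d + 1} {hL : Odd (ℓ + 1) ∧ 1 < ℓ + 1} {b₀ b₁ : ℝ}
variable (i : KIdx d ℓ hd hL b₀ b₁)

/-! ## §1 Generic letters: the word `P = G′Q′*X⁻¹Q′G′` in real coordinates and its level-free majorant ((3.49)₁) -/

section Generic

variable {𝔸 : Type} [NormedRing 𝔸] [NormedAlgebra ℂ 𝔸] [CompleteSpace 𝔸]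
variable {ι : Type} [Fintype ι] (b : Module.Basis ι ℝ 𝔸)
variable [Fintype (geo9K i).Site] [DecidableEq (geo9K i).Site] {Rr : ℝ} {Hp : Prop} (ιB : BlkY i → IBondY i)
variable (parS : SiteParY 𝔸 i) (Gp : SiteOpY 𝔸 i) (U : CfgY 𝔸 i)

omit [Fintype (geo9K i).Site] [DecidableEq (geo9K i).Site] in
/-- `R(U)Λ = Λ − G′(Q′*(X⁻¹(Q′(G′Λ))))` — def-Y's `RY` of (3.25), evaluated. [cite: Balaban1985BackgroundPropagators, (3.25) p.394] -/
theorem RY_apply' (Λ : SiteY i → 𝔸) :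
    RY i parS Gp U Λ = Λ - Gp U (QpsY i parS U (XinvY i parS Gp U (QpY i parS U (Gp U Λ)))) := rfl

omit [Fintype (geo9K i).Site] [DecidableEq (geo9K i).Site] in
/-- THE SCALE WEIGHTS CANCEL IN `P`: `(tG′)·Q′*·(sX⁻¹)·Q′·(tG′) = G′Q′*X⁻¹Q′G′` for `t·s·t = 1` (print: `G′ ↦ η²G′`, `(Q′G′²Q′*)⁻¹ ↦ η⁻⁴(Q′G′²Q′*)⁻¹`; `R`, `P`
are blind to the units). [cite: Balaban1985BackgroundPropagators, (3.25) p.394, bookkeeping] -/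
theorem smul_word_restrictScalars {t s : ℝ} (hts : t * s * t = 1) :
    (t • (Gp U).restrictScalars ℝ) ∘ₗ (QpsY i parS U).restrictScalars ℝ ∘ₗ (s • (XinvY i parS Gp U).restrictScalars ℝ) ∘ₗ
        (QpY i parS U).restrictScalars ℝ ∘ₗ (t • (Gp U).restrictScalars ℝ)
      = (Gp U ∘ₗ QpsY i parS U ∘ₗ XinvY i parS Gp U ∘ₗ QpY i parS U ∘ₗ Gp U).restrictScalars ℝ := by
  simp only [LinearMap.smul_comp, LinearMap.comp_smul, smul_smul, hts, one_smul]
  rfl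

omit [Fintype (geo9K i).Site] [DecidableEq (geo9K i).Site] in
/-- the word in real coordinates: `conj(tG′) ∘ conjHom(Q′*) ∘ conj(sX⁻¹) ∘ conjHom(Q′) ∘ conj(tG′) = conj((tG′)Q′*(sX⁻¹)Q′(tG′))` ([4] p. 232 «this property is
preserved under the composition of operators»). [cite: Balaban1984PropagatorsII, (2.51)–(2.52) p.232, bookkeeping] -/
theorem conj_word (t s : ℝ) :
    conj b (t • (Gp U).restrictScalars ℝ) ∘ₗ conjHom b ((QpsY i parS U).restrictScalars ℝ) ∘ₗ conj b (s • (XinvY i parS Gp U).restrictScalars ℝ) ∘ₗ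
        conjHom b ((QpY i parS U).restrictScalars ℝ) ∘ₗ conj b (t • (Gp U).restrictScalars ℝ)
      = conj b ((t • (Gp U).restrictScalars ℝ) ∘ₗ (QpsY i parS U).restrictScalars ℝ ∘ₗ (s • (XinvY i parS Gp U).restrictScalars ℝ) ∘ₗ
          (QpY i parS U).restrictScalars ℝ ∘ₗ (t • (Gp U).restrictScalars ℝ)) := by
  simp only [← conjHom_eq_conj, conjHom_comp]

/-- ★★ **(3.49)₁ FOR `P(U) = G′Q′*(Q′G′²Q′*)⁻¹Q′G′` AT GENERIC LETTERS `parS`, `Gp`** (p. 399 «using again Lemma 2.1»): contractive transporters, a real basis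
`b` with coordinate bound `M₂`, the geometry ((2.54), `d ≧ 0`, (2.61) at `β`, the scale transfers of `ℓ²` and `ℓ⁻⁴` at exponent `α` with constant `Λ ≧ 1`),
`ρ + (2α+β)δ₀ ≦ δ`, `t·s·t = 1`; the DISPLAYED (3.42)₁ majorant `A·ℓ(a)²·e^{−δd}` of `conj b(tG′)` on the site carrier and the DISPLAYED (3.48)-shape majorant
`K·ℓ(a)⁻⁴·e^{−δd}` of `conj b(s·X⁻¹)` on the block carrier ⟹ `conj b(G′Q′*X⁻¹Q′G′) ≺ (M₂Σ‖b_j‖)²·A·K·A·Λ⁴·c₁(δ₀,β)² · e^{−ρd}` — LEVEL-FREE (`ℓ²·ℓ⁻⁴·ℓ² = 1`).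
[cite: Balaban1985BackgroundPropagators, (3.49) p.399, (3.25) p.394, Thm 3.1 (3.42) p.397, Thm 3.2 (3.48) p.398, p.398 (scale transfer), (3.19) p.393; Balaban1984PropagatorsII, (2.51)–(2.52) p.232, Lemma 2.1 (2.61) p.234] -/
theorem hasMajorant_conj_P (hpar : ∀ z w : SiteY i, ‖(parS U z w : 𝔸)‖ ≤ 1 ∧ ‖(((parS U z w)⁻¹ : 𝔸ˣ) : 𝔸)‖ ≤ 1)
    {M₂ : ℝ} (hM₂ : 0 ≤ M₂) (hrepr : ∀ (v : 𝔸) (j : ι), |b.repr v j| ≤ M₂ * ‖v‖)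
    (d₁ : ℕ) {δ₀ δ α βx ρ Λ A K t s : ℝ} (hA : 0 ≤ A) (hK : 0 ≤ K) (hΛ : 1 ≤ Λ) (hρ : 0 ≤ ρ) (hα : 0 ≤ α) (hβ : 0 ≤ βx) (hδ₀ : 0 ≤ δ₀)
    (hr : ρ + (2 * α + βx) * δ₀ ≤ δ) (hts : t * s * t = 1)
    (hdnn : ∀ a a' : (geo9K i).Site, 0 ≤ (geo9K i).dist a a') (htri : Triangle254 (toB6 (geo9K i) Rr Hp))
    (h261 : Ineq261 d₁ (toB6 (geo9K i) Rr Hp) δ₀ βx)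
    (hT2 : ScaleTransfer (geo9K i) δ₀ α Λ (fun a => (geo9K i).len a ^ 2))
    (hT4 : ScaleTransfer (geo9K i) δ₀ α Λ (fun a => ((geo9K i).len a ^ 4)⁻¹))
    (hG : HasMajorant (g := toB6 (geo9K i) Rr Hp) (fun p : SiteY i × ι => ιB (blkOf i.D.toDomains p.1))
      (conj b (t • (Gp U).restrictScalars ℝ)) (fun a a' => A * (geo9K i).len a ^ 2 * Real.exp (-(δ * (geo9K i).dist a a'))))
    (hC : HasMajorant (g := toB6 (geo9K i) Rr Hp) (fun q : BlkY i × ι => ιB q.1)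
      (conj b (s • (XinvY i parS Gp U).restrictScalars ℝ)) (fun a a' => K * ((geo9K i).len a ^ 4)⁻¹ * Real.exp (-(δ * (geo9K i).dist a a')))) :
    HasMajorant (g := toB6 (geo9K i) Rr Hp) (fun p : SiteY i × ι => ιB (blkOf i.D.toDomains p.1))
      (conj b ((Gp U ∘ₗ QpsY i parS U ∘ₗ XinvY i parS Gp U ∘ₗ QpY i parS U ∘ₗ Gp U).restrictScalars ℝ))
      (fun a a' => ((M₂ * ∑ j, ‖b j‖) ^ 2 * A * K * A * Λ ^ 4 * B6.c1 d₁ δ₀ βx ^ 2) * Real.exp (-(ρ * (geo9K i).dist a a'))) := by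
  have hlen : ∀ a : (geo9K i).Site, 0 < (geo9K i).len a := fun a => by rw [geo9K_len_kGeo]; exact len_pos i a
  have hw2 : ∀ a : (geo9K i).Site, 0 ≤ (geo9K i).len a ^ 2 := fun a => sq_nonneg _
  have hκ : 0 ≤ M₂ * ∑ j, ‖b j‖ := mul_nonneg hM₂ (Finset.sum_nonneg fun j _ => norm_nonneg (b j))
  have hGh := (hasMajorantHom_iff (g := toB6 (geo9K i) Rr Hp) (fun p : SiteY i × ι => ιB (blkOf i.D.toDomains p.1)) _ _).mpr hG
  have hw := hasMajorantHom_word349 (R := Rr) (H := Hp) (fun p : SiteY i × ι => ιB (blkOf i.D.toDomains p.1))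
    (fun p : SiteY i × ι => ιB (blkOf i.D.toDomains p.1)) (fun p : SiteY i × ι => ιB (blkOf i.D.toDomains p.1)) (fun q : BlkY i × ι => ιB q.1)
    d₁ δ₀ δ α βx ρ Λ (M₂ * ∑ j, ‖b j‖) A K A (fun a => (geo9K i).len a ^ 2) (fun a => (geo9K i).len a ^ 2) hw2 hw2 hκ hA hK hA hΛ hρ hα hβ hδ₀ hr
    hdnn htri h261 hT2 hT4 hGh hGh (hasMajorantHom_conjHom_QpY i b ιB parS U hpar hM₂ hrepr) (hasMajorantHom_conjHom_QpsY i b ιB parS U hpar hM₂ hrepr) hC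
  rw [conj_word, smul_word_restrictScalars i parS Gp U hts] at hw
  refine (hasMajorantHom_iff (g := toB6 (geo9K i) Rr Hp) _ _ _).mp (hasMajorantHom_mono (g := toB6 (geo9K i) Rr Hp) _ _ hw fun a a' => le_of_eq ?_)
  have ha : (geo9K i).len a ≠ 0 := (hlen a).ne'
  field_simp

end Generic

/-! ## §2 A constant-level member: every coarse point has the block scale `Lⁿ∕|c_f|`, so the p. 398 scale transfer is free -/

section ConstLev

variable (ιB : BlkY i → IBondY i)

/-- on a member with constant level function `= n`, EVERY coarse point (index bond) has level `n`. [cite: Balaban1984PropagatorsII, (2.3)–(2.4) p.224, (2.45) p.231; Balaban1985RegularSpaces, p.77 («Ω_j = T_η»)] -/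
theorem lvl_eq_of_constLev {n : ℕ} (hlev : ∀ z : SiteY i, levY i z = n) (a : IBondY i) : lvl i.hN i.D i.hk a = n := by
  have hk1 : 1 ≤ i.k := le_trans (by norm_num) i.hk2
  rw [← beta_level i.hN i.D i.hk hk1, ← levY_blkCornerY i (β i.hN i.D i.hk a), hlev]

/-- hence the block scale of the member's geometry is the constant `Lⁿ∕|c_f|` (`= Lⁿη` in print's units). [cite: Balaban1984PropagatorsII, (2.1) p.224; Balaban1985BackgroundPropagators, (3.41) p.397 («Lʲη»)] -/
theorem geo9K_len_constLev {n : ℕ} (hlev : ∀ z : SiteY i, levY i z = n) (a : (geo9K i).Site) :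
    (geo9K i).len a = (((ℓ + 1 : ℕ) : ℝ)) ^ n / |i.cf| := by
  rw [geo9K_len_kGeo, len_eq i, lvl_eq_of_constLev i hlev a]

/-- ★ **THE SCALE TRANSFER OF p. 398 IS FREE ON A CONSTANT-LEVEL MEMBER**: any weight that is a function of the block scale transfers at exponent `0` with
constant `1`. [cite: Balaban1985BackgroundPropagators, p.398 («we may replace the factor (Lʲη)^α by (Lʲη)^β(L^{j′}η)^γ»); Balaban1985RegularSpaces, p.77 («Ω_j = T_η»)] -/
theorem scaleTransfer_of_constLev {n : ℕ} (hlev : ∀ z : SiteY i, levY i z = n) (δ₀ : ℝ) (f : ℝ → ℝ) :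
    ScaleTransfer (geo9K i) δ₀ 0 1 (fun a => f ((geo9K i).len a)) := by
  intro y y'
  simp only [zero_mul, neg_zero, Real.exp_zero, one_mul, geo9K_len_constLev i hlev, le_refl]

end ConstLev

/-! ## §3 At the knit letter: (3.49)₁ and the consumer's (E15) -/

section Knit

variable {N : ℕ} {G : Subgroup (Matrix (Fin N) (Fin N) ℂ)ˣ}
variable {ι : Type} [Fintype ι] (b : Module.Basis ι ℝ (Matrix (Fin N) (Fin N) ℂ))
variable [Fintype (geo9K i).Site] [DecidableEq (geo9K i).Site] {Rr : ℝ} {Hp : Prop} (ιB : BlkY i → IBondY i)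

omit [Fintype (geo9K i).Site] [DecidableEq (geo9K i).Site] in
/-- the knit legs are contraction pairs when `G`-valued, `G ≤ U(N)`, `N ≥ 1` (junction file 6's `contraction_of_mem_unitary`).
[cite: Balaban1985BackgroundPropagators, (3.19) p.393 (unitary transporters); Balaban1985Averaging, (52)–(53) pp.26–27] -/
theorem parKnitY_contractive [Nonempty (Fin N)] (hG : G ≤ B7Prop2Explicit.unitaryUnits (Matrix (Fin N) (Fin N) ℂ))
    {U : CfgY (Matrix (Fin N) (Fin N) ℂ) i} (hpar : ∀ z w : SiteY i, parKnitY i U z w ∈ G) (z w : SiteY i) :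
    ‖(parKnitY i U z w : Matrix (Fin N) (Fin N) ℂ)‖ ≤ 1 ∧ ‖(((parKnitY i U z w)⁻¹ : (Matrix (Fin N) (Fin N) ℂ)ˣ) : Matrix (Fin N) (Fin N) ℂ)‖ ≤ 1 :=
  contraction_of_mem_unitary hG (hpar z w)

/-- ★★ **(3.49)₁ AT THE KNIT LETTER**: for `G ≤ U(N)` (`N ≥ 1`), `G`-valued knit legs, a real basis `b` (coordinate bound `M₂`), the geometry, `ρ + (2α+β)δ₀ ≦ δ`,
`η²·s·η² = 1` (`η = etaS i`), the DISPLAYED (3.42)₁ majorant `A·ℓ²·e^{−δd}` of `conj b(η²G′(U; parKnitY))` (junction file 15's output shape) and the DISPLAYED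
(3.48)-shape majorant `K·ℓ⁻⁴·e^{−δd}` of `conj b(s·(Q′G′²Q′*)⁻¹(U; parKnitY))` (M5.6's output shape at `parS := parKnitY`):
`conj b(G′Q′*(Q′G′²Q′*)⁻¹Q′G′) ≺ (M₂Σ‖b_j‖)²AKAΛ⁴c₁² · e^{−ρd}`.
[cite: Balaban1985BackgroundPropagators, (3.49) p.399, (3.25) p.394, Thm 3.1 (3.42) p.397, Thm 3.2 (3.48) p.398; Balaban1984PropagatorsII, (2.52) p.232, (2.61) p.234] -/
theorem hasMajorant_conj_P_parKnitY [Nonempty (Fin N)] (hG : G ≤ B7Prop2Explicit.unitaryUnits (Matrix (Fin N) (Fin N) ℂ))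
    {U : CfgY (Matrix (Fin N) (Fin N) ℂ) i} (hpar : ∀ z w : SiteY i, parKnitY i U z w ∈ G)
    {M₂ : ℝ} (hM₂ : 0 ≤ M₂) (hrepr : ∀ (v : Matrix (Fin N) (Fin N) ℂ) (j : ι), |b.repr v j| ≤ M₂ * ‖v‖)
    (d₁ : ℕ) {δ₀ δ α βx ρ Λ A K s : ℝ} (hA : 0 ≤ A) (hK : 0 ≤ K) (hΛ : 1 ≤ Λ) (hρ : 0 ≤ ρ) (hα : 0 ≤ α) (hβ : 0 ≤ βx) (hδ₀ : 0 ≤ δ₀)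
    (hr : ρ + (2 * α + βx) * δ₀ ≤ δ) (hs : (etaS i ^ 2 * etaS i ^ 2) * s = 1)
    (hdnn : ∀ a a' : (geo9K i).Site, 0 ≤ (geo9K i).dist a a') (htri : Triangle254 (toB6 (geo9K i) Rr Hp))
    (h261 : Ineq261 d₁ (toB6 (geo9K i) Rr Hp) δ₀ βx)
    (hT2 : ScaleTransfer (geo9K i) δ₀ α Λ (fun a => (geo9K i).len a ^ 2))
    (hT4 : ScaleTransfer (geo9K i) δ₀ α Λ (fun a => ((geo9K i).len a ^ 4)⁻¹))
    (hGm : HasMajorant (g := toB6 (geo9K i) Rr Hp) (fun p : SiteY i × ι => ιB (blkOf i.D.toDomains p.1))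
      (conj b ((etaS i ^ 2) • (GpY i (parKnitY i) U).restrictScalars ℝ)) (fun a a' => A * (geo9K i).len a ^ 2 * Real.exp (-(δ * (geo9K i).dist a a'))))
    (hC : HasMajorant (g := toB6 (geo9K i) Rr Hp) (fun q : BlkY i × ι => ιB q.1)
      (conj b (s • (XinvY i (parKnitY i) (GpY i (parKnitY i)) U).restrictScalars ℝ))
      (fun a a' => K * ((geo9K i).len a ^ 4)⁻¹ * Real.exp (-(δ * (geo9K i).dist a a')))) :
    HasMajorant (g := toB6 (geo9K i) Rr Hp) (fun p : SiteY i × ι => ιB (blkOf i.D.toDomains p.1))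
      (conj b ((GpY i (parKnitY i) U ∘ₗ QpsY i (parKnitY i) U ∘ₗ XinvY i (parKnitY i) (GpY i (parKnitY i)) U ∘ₗ QpY i (parKnitY i) U ∘ₗ
        GpY i (parKnitY i) U).restrictScalars ℝ))
      (fun a a' => ((M₂ * ∑ j, ‖b j‖) ^ 2 * A * K * A * Λ ^ 4 * B6.c1 d₁ δ₀ βx ^ 2) * Real.exp (-(ρ * (geo9K i).dist a a'))) :=
  hasMajorant_conj_P i b ιB (parKnitY i) (GpY i (parKnitY i)) U (parKnitY_contractive i hG hpar) hM₂ hrepr d₁ hA hK hΛ hρ hα hβ hδ₀ hr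
    (by rw [show etaS i ^ 2 * s * etaS i ^ 2 = etaS i ^ 2 * etaS i ^ 2 * s by ring]; exact hs) hdnn htri h261 hT2 hT4 hGm hC

/-- ★★ **THE SUP BOUND OF `P(U) = G′Q′*(Q′G′²Q′*)⁻¹Q′G′` AT THE KNIT LETTER** (p. 92 «|Rf| ≦ B′₀|f|» minus the identity): under the hypotheses of
`hasMajorant_conj_P_parKnitY` and the row sum `Σ_{a′}e^{−ρd(a,a′)} ≦ c`: `‖Λ(w)‖ ≦ M ∀w ⇒ ‖(G′Q′*(Q′G′²Q′*)⁻¹Q′G′Λ)(z)‖ ≦ (Σ‖b_j‖)·κ_P·c·M₂·M`.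
[cite: Balaban1985RegularSpaces, p.92 («|Rf| ≦ B′₀|f|»); Balaban1985BackgroundPropagators, (3.49) p.399, (3.47) p.398; Balaban1984PropagatorsII, (2.51)–(2.52) p.232, (2.61) p.234] -/
theorem norm_P_parKnitY_apply_le [Nonempty (Fin N)] (hG : G ≤ B7Prop2Explicit.unitaryUnits (Matrix (Fin N) (Fin N) ℂ))
    {U : CfgY (Matrix (Fin N) (Fin N) ℂ) i} (hpar : ∀ z w : SiteY i, parKnitY i U z w ∈ G)
    {M₂ : ℝ} (hM₂ : 0 ≤ M₂) (hrepr : ∀ (v : Matrix (Fin N) (Fin N) ℂ) (j : ι), |b.repr v j| ≤ M₂ * ‖v‖)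
    (d₁ : ℕ) {δ₀ δ α βx ρ Λ A K s c : ℝ} (hA : 0 ≤ A) (hK : 0 ≤ K) (hΛ : 1 ≤ Λ) (hρ : 0 ≤ ρ) (hα : 0 ≤ α) (hβ : 0 ≤ βx) (hδ₀ : 0 ≤ δ₀)
    (hr : ρ + (2 * α + βx) * δ₀ ≤ δ) (hs : (etaS i ^ 2 * etaS i ^ 2) * s = 1)
    (hdnn : ∀ a a' : (geo9K i).Site, 0 ≤ (geo9K i).dist a a') (htri : Triangle254 (toB6 (geo9K i) Rr Hp))
    (h261 : Ineq261 d₁ (toB6 (geo9K i) Rr Hp) δ₀ βx)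
    (hT2 : ScaleTransfer (geo9K i) δ₀ α Λ (fun a => (geo9K i).len a ^ 2))
    (hT4 : ScaleTransfer (geo9K i) δ₀ α Λ (fun a => ((geo9K i).len a ^ 4)⁻¹))
    (hGm : HasMajorant (g := toB6 (geo9K i) Rr Hp) (fun p : SiteY i × ι => ιB (blkOf i.D.toDomains p.1))
      (conj b ((etaS i ^ 2) • (GpY i (parKnitY i) U).restrictScalars ℝ)) (fun a a' => A * (geo9K i).len a ^ 2 * Real.exp (-(δ * (geo9K i).dist a a'))))
    (hC : HasMajorant (g := toB6 (geo9K i) Rr Hp) (fun q : BlkY i × ι => ιB q.1)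
      (conj b (s • (XinvY i (parKnitY i) (GpY i (parKnitY i)) U).restrictScalars ℝ))
      (fun a a' => K * ((geo9K i).len a ^ 4)⁻¹ * Real.exp (-(δ * (geo9K i).dist a a'))))
    (hrow : ∀ a : (geo9K i).Site, ∑ a' : (geo9K i).Site, Real.exp (-(ρ * (geo9K i).dist a a')) ≤ c)
    (Λf : SiteY i → Matrix (Fin N) (Fin N) ℂ) {M : ℝ} (hΛf : ∀ w, ‖Λf w‖ ≤ M) (z : SiteY i) :
    ‖GpY i (parKnitY i) U (QpsY i (parKnitY i) U (XinvY i (parKnitY i) (GpY i (parKnitY i)) U (QpY i (parKnitY i) U (GpY i (parKnitY i) U Λf)))) z‖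
      ≤ (∑ j, ‖b j‖) * (((M₂ * ∑ j, ‖b j‖) ^ 2 * A * K * A * Λ ^ 4 * B6.c1 d₁ δ₀ βx ^ 2) * c * (M₂ * M)) := by
  have hP := hasMajorant_conj_P_parKnitY i b ιB hG hpar hM₂ hrepr d₁ hA hK hΛ hρ hα hβ hδ₀ hr hs hdnn htri h261 hT2 hT4 hGm hC
  have hκ : 0 ≤ (M₂ * ∑ j, ‖b j‖) ^ 2 * A * K * A * Λ ^ 4 * B6.c1 d₁ δ₀ βx ^ 2 := by
    have := c1_nonneg d₁ δ₀ βx; positivity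
  have hP' : HasMajorant (g := toB6 (geo9K i) Rr Hp) (fun p : SiteY i × ι => ιB (blkOf i.D.toDomains p.1))
      (conj b ((GpY i (parKnitY i) U ∘ₗ QpsY i (parKnitY i) U ∘ₗ XinvY i (parKnitY i) (GpY i (parKnitY i)) U ∘ₗ QpY i (parKnitY i) U ∘ₗ
        GpY i (parKnitY i) U).restrictScalars ℝ))
      (fun a a' => ((M₂ * ∑ j, ‖b j‖) ^ 2 * A * K * A * Λ ^ 4 * B6.c1 d₁ δ₀ βx ^ 2) * (fun _ : (geo9K i).Site => (1 : ℝ)) a *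
        Real.exp (-(ρ * (geo9K i).dist a a'))) :=
    hasMajorant_mono (g := toB6 (geo9K i) Rr Hp) _ hP fun a a' => le_of_eq (by rw [mul_one])
  have h := norm_apply_le_of_hasMajorant_exp i b ιB _ hκ (fun _ => zero_le_one) hP' hrow hM₂ hrepr Λf hΛf z
  rw [mul_one] at h
  exact h

/-- ★★★ **(E15) `r_bound` AT THE KNIT LETTER, EVERY WEIGHT**: under the hypotheses of `norm_P_parKnitY_apply_le`, for every weight `ω > 0`:
`ω‖Λ(w)‖ ≦ r ∀w ⇒ ω‖(R(U)Λ)(z)‖ ≦ (1 + (Σ‖b_j‖)·κ_P·c·M₂)·r`, `R(U) = I − G′Q′*(Q′G′²Q′*)⁻¹Q′G′` at `parKnitY` ([B8] (1.98) `|Rf|₍₋₂₎ ≦ B_R|f|₍₋₂₎`: the weight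
`(Lʲη)²` of `|·|₍₋₂₎` is any such `ω`; `B_R = 1 + (Σ‖b_j‖)κ_P c M₂` free of the member, `n`, `k`, `N`, `η`).
[cite: Balaban1985RegularSpaces, (1.98) p.92, p.86 (|·|₍₋₂₎); Balaban1985BackgroundPropagators, (3.25) p.394, (3.49) p.399] -/
theorem knit_E15 [Nonempty (Fin N)] (hG : G ≤ B7Prop2Explicit.unitaryUnits (Matrix (Fin N) (Fin N) ℂ))
    {U : CfgY (Matrix (Fin N) (Fin N) ℂ) i} (hpar : ∀ z w : SiteY i, parKnitY i U z w ∈ G)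
    {M₂ : ℝ} (hM₂ : 0 ≤ M₂) (hrepr : ∀ (v : Matrix (Fin N) (Fin N) ℂ) (j : ι), |b.repr v j| ≤ M₂ * ‖v‖)
    (d₁ : ℕ) {δ₀ δ α βx ρ Λ A K s c : ℝ} (hA : 0 ≤ A) (hK : 0 ≤ K) (hΛ : 1 ≤ Λ) (hρ : 0 ≤ ρ) (hα : 0 ≤ α) (hβ : 0 ≤ βx) (hδ₀ : 0 ≤ δ₀)
    (hr : ρ + (2 * α + βx) * δ₀ ≤ δ) (hs : (etaS i ^ 2 * etaS i ^ 2) * s = 1)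
    (hdnn : ∀ a a' : (geo9K i).Site, 0 ≤ (geo9K i).dist a a') (htri : Triangle254 (toB6 (geo9K i) Rr Hp))
    (h261 : Ineq261 d₁ (toB6 (geo9K i) Rr Hp) δ₀ βx)
    (hT2 : ScaleTransfer (geo9K i) δ₀ α Λ (fun a => (geo9K i).len a ^ 2))
    (hT4 : ScaleTransfer (geo9K i) δ₀ α Λ (fun a => ((geo9K i).len a ^ 4)⁻¹))
    (hGm : HasMajorant (g := toB6 (geo9K i) Rr Hp) (fun p : SiteY i × ι => ιB (blkOf i.D.toDomains p.1))
      (conj b ((etaS i ^ 2) • (GpY i (parKnitY i) U).restrictScalars ℝ)) (fun a a' => A * (geo9K i).len a ^ 2 * Real.exp (-(δ * (geo9K i).dist a a'))))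
    (hC : HasMajorant (g := toB6 (geo9K i) Rr Hp) (fun q : BlkY i × ι => ιB q.1)
      (conj b (s • (XinvY i (parKnitY i) (GpY i (parKnitY i)) U).restrictScalars ℝ))
      (fun a a' => K * ((geo9K i).len a ^ 4)⁻¹ * Real.exp (-(δ * (geo9K i).dist a a'))))
    (hrow : ∀ a : (geo9K i).Site, ∑ a' : (geo9K i).Site, Real.exp (-(ρ * (geo9K i).dist a a')) ≤ c)
    {ω : ℝ} (hω : 0 < ω) (Λf : SiteY i → Matrix (Fin N) (Fin N) ℂ) {r : ℝ} (hΛf : ∀ w, ω * ‖Λf w‖ ≤ r) (z : SiteY i) :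
    ω * ‖RY i (parKnitY i) (GpY i (parKnitY i)) U Λf z‖
      ≤ (1 + (∑ j, ‖b j‖) * (((M₂ * ∑ j, ‖b j‖) ^ 2 * A * K * A * Λ ^ 4 * B6.c1 d₁ δ₀ βx ^ 2) * c * M₂)) * r := by
  have hΛ' : ∀ w, ‖Λf w‖ ≤ r / ω := fun w => by rw [le_div_iff₀ hω, mul_comm]; exact hΛf w
  have hr0 : 0 ≤ r := le_trans (mul_nonneg hω.le (norm_nonneg _)) (hΛf z)
  have hP := norm_P_parKnitY_apply_le i b ιB hG hpar hM₂ hrepr d₁ hA hK hΛ hρ hα hβ hδ₀ hr hs hdnn htri h261 hT2 hT4 hGm hC hrow Λf hΛ' z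
  rw [RY_apply', Pi.sub_apply]
  have h1 : ω * ‖Λf z - GpY i (parKnitY i) U (QpsY i (parKnitY i) U (XinvY i (parKnitY i) (GpY i (parKnitY i)) U
      (QpY i (parKnitY i) U (GpY i (parKnitY i) U Λf)))) z‖
      ≤ ω * (r / ω) + ω * ((∑ j, ‖b j‖) * (((M₂ * ∑ j, ‖b j‖) ^ 2 * A * K * A * Λ ^ 4 * B6.c1 d₁ δ₀ βx ^ 2) * c * (M₂ * (r / ω)))) := by
    rw [← mul_add]
    exact mul_le_mul_of_nonneg_left ((norm_sub_le _ _).trans (add_le_add (hΛ' z) hP)) hω.le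
  refine h1.trans (le_of_eq ?_)
  field_simp

/-- (E15) at the `c′`-scaled letter `c′·G′(U; parKnitY)` (`c′ ≠ 0`; the consumer's `η²G′`): `R` does not see the units of `G′` (junction file 13's
`RY_parKnitY_smul`), so the same bound holds verbatim. [cite: Balaban1985RegularSpaces, (1.98) p.92, (1.95) p.92; Balaban1985BackgroundPropagators, (3.25) p.394] -/
theorem knit_E15_smul [Nonempty (Fin N)] (hG : G ≤ B7Prop2Explicit.unitaryUnits (Matrix (Fin N) (Fin N) ℂ))
    {U : CfgY (Matrix (Fin N) (Fin N) ℂ) i} (hpar : ∀ z w : SiteY i, parKnitY i U z w ∈ G)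
    {M₂ : ℝ} (hM₂ : 0 ≤ M₂) (hrepr : ∀ (v : Matrix (Fin N) (Fin N) ℂ) (j : ι), |b.repr v j| ≤ M₂ * ‖v‖)
    (d₁ : ℕ) {δ₀ δ α βx ρ Λ A K s c : ℝ} (hA : 0 ≤ A) (hK : 0 ≤ K) (hΛ : 1 ≤ Λ) (hρ : 0 ≤ ρ) (hα : 0 ≤ α) (hβ : 0 ≤ βx) (hδ₀ : 0 ≤ δ₀)
    (hr : ρ + (2 * α + βx) * δ₀ ≤ δ) (hs : (etaS i ^ 2 * etaS i ^ 2) * s = 1)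
    (hdnn : ∀ a a' : (geo9K i).Site, 0 ≤ (geo9K i).dist a a') (htri : Triangle254 (toB6 (geo9K i) Rr Hp))
    (h261 : Ineq261 d₁ (toB6 (geo9K i) Rr Hp) δ₀ βx)
    (hT2 : ScaleTransfer (geo9K i) δ₀ α Λ (fun a => (geo9K i).len a ^ 2))
    (hT4 : ScaleTransfer (geo9K i) δ₀ α Λ (fun a => ((geo9K i).len a ^ 4)⁻¹))
    (hGm : HasMajorant (g := toB6 (geo9K i) Rr Hp) (fun p : SiteY i × ι => ιB (blkOf i.D.toDomains p.1))
      (conj b ((etaS i ^ 2) • (GpY i (parKnitY i) U).restrictScalars ℝ)) (fun a a' => A * (geo9K i).len a ^ 2 * Real.exp (-(δ * (geo9K i).dist a a'))))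
    (hC : HasMajorant (g := toB6 (geo9K i) Rr Hp) (fun q : BlkY i × ι => ιB q.1)
      (conj b (s • (XinvY i (parKnitY i) (GpY i (parKnitY i)) U).restrictScalars ℝ))
      (fun a a' => K * ((geo9K i).len a ^ 4)⁻¹ * Real.exp (-(δ * (geo9K i).dist a a'))))
    (hrow : ∀ a : (geo9K i).Site, ∑ a' : (geo9K i).Site, Real.exp (-(ρ * (geo9K i).dist a a')) ≤ c)
    {c' : ℂ} (hc' : c' ≠ 0) {ω : ℝ} (hω : 0 < ω) (Λf : SiteY i → Matrix (Fin N) (Fin N) ℂ) {r : ℝ} (hΛf : ∀ w, ω * ‖Λf w‖ ≤ r) (z : SiteY i) :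
    ω * ‖RY i (parKnitY i) (c' • GpY i (parKnitY i)) U Λf z‖
      ≤ (1 + (∑ j, ‖b j‖) * (((M₂ * ∑ j, ‖b j‖) ^ 2 * A * K * A * Λ ^ 4 * B6.c1 d₁ δ₀ βx ^ 2) * c * M₂)) * r := by
  rw [RY_parKnitY_smul i U hc']
  exact knit_E15 i b ιB hG hpar hM₂ hrepr d₁ hA hK hΛ hρ hα hβ hδ₀ hr hs hdnn htri h261 hT2 hT4 hGm hC hrow hω Λf hΛf z

/-- ★★★ **(E15) `r_bound` OF `B8Thm2TorusLetters.LettersAt` AT THE KNIT LETTER, CONSTANT-LEVEL MEMBER** (the trivial domain sequence `Ω_j = T_η` of the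
consumer; the scale transfers are discharged by `scaleTransfer_of_constLev`, `α = 0`, `Λ = 1`): for `G ≤ U(N)` (`N ≥ 1`), `G`-valued knit legs, the geometry
((2.54), `d ≧ 0`, (2.61) at `β`), `ρ + βδ₀ ≦ δ`, `η²·s·η² = 1`, the two DISPLAYED majorants and the row sum at `ρ`; `η′ ≠ 0` and
`(Lⁿη′)²‖Λ(w)‖ ≦ r` for all `w` ⟹ `(Lⁿη′)²‖(R(U)Λ)(z)‖ ≦ (1 + (Σ‖b_j‖)·(M₂Σ‖b_j‖)²AKAc₁²·c·M₂)·r`.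
[cite: Balaban1985RegularSpaces, (1.98) p.92, p.86 (|·|₍₋₂₎), p.77 («Ω_j = T_η»); Balaban1985BackgroundPropagators, (3.25) p.394, (3.49) p.399, Thm 3.1 (3.42) p.397, Thm 3.2 (3.48) p.398; Balaban1984PropagatorsII, (2.61) p.234] -/
theorem knit_E15_constLev [Nonempty (Fin N)] {n : ℕ} (hlev : ∀ z : SiteY i, levY i z = n)
    (hG : G ≤ B7Prop2Explicit.unitaryUnits (Matrix (Fin N) (Fin N) ℂ))
    {U : CfgY (Matrix (Fin N) (Fin N) ℂ) i} (hpar : ∀ z w : SiteY i, parKnitY i U z w ∈ G)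
    {M₂ : ℝ} (hM₂ : 0 ≤ M₂) (hrepr : ∀ (v : Matrix (Fin N) (Fin N) ℂ) (j : ι), |b.repr v j| ≤ M₂ * ‖v‖)
    (d₁ : ℕ) {δ₀ δ βx ρ A K s c : ℝ} (hA : 0 ≤ A) (hK : 0 ≤ K) (hρ : 0 ≤ ρ) (hβ : 0 ≤ βx) (hδ₀ : 0 ≤ δ₀)
    (hr : ρ + βx * δ₀ ≤ δ) (hs : (etaS i ^ 2 * etaS i ^ 2) * s = 1)
    (hdnn : ∀ a a' : (geo9K i).Site, 0 ≤ (geo9K i).dist a a') (htri : Triangle254 (toB6 (geo9K i) Rr Hp))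
    (h261 : Ineq261 d₁ (toB6 (geo9K i) Rr Hp) δ₀ βx)
    (hGm : HasMajorant (g := toB6 (geo9K i) Rr Hp) (fun p : SiteY i × ι => ιB (blkOf i.D.toDomains p.1))
      (conj b ((etaS i ^ 2) • (GpY i (parKnitY i) U).restrictScalars ℝ)) (fun a a' => A * (geo9K i).len a ^ 2 * Real.exp (-(δ * (geo9K i).dist a a'))))
    (hC : HasMajorant (g := toB6 (geo9K i) Rr Hp) (fun q : BlkY i × ι => ιB q.1)
      (conj b (s • (XinvY i (parKnitY i) (GpY i (parKnitY i)) U).restrictScalars ℝ))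
      (fun a a' => K * ((geo9K i).len a ^ 4)⁻¹ * Real.exp (-(δ * (geo9K i).dist a a'))))
    (hrow : ∀ a : (geo9K i).Site, ∑ a' : (geo9K i).Site, Real.exp (-(ρ * (geo9K i).dist a a')) ≤ c)
    {η' : ℝ} (hη : η' ≠ 0) (Λf : SiteY i → Matrix (Fin N) (Fin N) ℂ) {r : ℝ} (hΛf : ∀ w, ((((ℓ + 1 : ℕ) : ℝ)) ^ n * η') ^ 2 * ‖Λf w‖ ≤ r)
    (z : SiteY i) :
    ((((ℓ + 1 : ℕ) : ℝ)) ^ n * η') ^ 2 * ‖RY i (parKnitY i) (GpY i (parKnitY i)) U Λf z‖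
      ≤ (1 + (∑ j, ‖b j‖) * (((M₂ * ∑ j, ‖b j‖) ^ 2 * A * K * A * B6.c1 d₁ δ₀ βx ^ 2) * c * M₂)) * r := by
  have hω : 0 < ((((ℓ + 1 : ℕ) : ℝ)) ^ n * η') ^ 2 := by positivity
  have hr' : ρ + (2 * 0 + βx) * δ₀ ≤ δ := by rw [mul_zero, zero_add]; exact hr
  have h := knit_E15 i b ιB hG hpar hM₂ hrepr d₁ hA hK le_rfl hρ le_rfl hβ hδ₀ hr' hs hdnn htri h261
    (scaleTransfer_of_constLev i hlev δ₀ fun x => x ^ 2) (scaleTransfer_of_constLev i hlev δ₀ fun x => (x ^ 4)⁻¹) hGm hC hrow hω Λf hΛf z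
  rw [one_pow, mul_one] at h
  exact h

end Knit

end Literature.MathematicalPhysics.QuantumFieldTheory.Balaban1983to89.B9B8KnitLetterRBound

end
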